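import Literature.NumberTheory.EllipticCurves.BigRepModuleShiftStructureProofs
import Literature.NumberTheory.EllipticCurves.BigRepModuleCoeffExtension
import Literature.NumberTheory.IwasawaTheory.PruferPontryaginDual
import Literature.NumberTheory.GaloisRepresentations.GaloisRep
import Summits.BirchSwinnertonDyer.BirchSwinnertonDyer.Theorems.EisensteinPrimesAcTwistDeformationCofreeRank
import Summits.BirchSwinnertonDyer.BirchSwinnertonDyer.Theorems.EisensteinPrimesGreenbergFullAtSelmer
import HarnessLib

/-!
# [telescope — width x2-p2 g23, 2026-08-30] THE COFREE REALISATION OF A FRAMED `Λ`-ADIC REPRESENTATION: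
# `ρ : G →ₜ* GL_n(ℤ_p⟦X⟧)` continuous ⟹ a `ContinuousRep G ℤ_p⟦X⟧ A₂` on the DISCRETE, `ℤ_p⟦X⟧`-COFREE module
# `A₂ = (Λ^*)ⁿ = Fin n → BigRepModule ℤ_[p] p (ℚ_p/ℤ_p)` (`= T ⊗_Λ Λ^∨` for the free lattice `T = Λⁿ`), with (cof), (tor)
# `X`-power torsion, (div) divisibility by every non-zero `f ∈ Λ` (so (cof₀)/(cof_k)), and unramifiedness transferred from `ρ`
# Crux 4 `BSDpOnCellC` (stmt-BirchSwinnertonDyer-19034), line «telescope», leaf N1 `stub_branchLattice` (`--supports`, helper; closes nothing)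

WHY (N1-TYPING-x2p2g23.md §4 (R-c)(v), evidence #59 on -19034): leaf N1 asks for `∃ A₂ … (ρ₂ : ContinuousRep Γ_K ℤ_p⟦X⟧ A₂) …,
IsCofree ℤ_p⟦X⟧ A₂ ∧ (tor) ∧ (cof₀) ∧ (cof_k) ∧ (unr) ∧ (fd₀) ∧ (rat_k) ∧ (fd_k)` — the discrete avatar `A₂ = T₂ ⊗ Λ^∨` of Hida's/Wiles'
FREE rank-2 `ℤ_p⟦X⟧`-lattice `T₂` with its continuous Galois action. Whatever produces `T₂` (Hida 1986 Thm. 2.1 / Wiles 1988 §2 /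
a pseudo-character interpolation along the ℚ_p-rational chart), it arrives FRAMED: a continuous `ρ : G →ₜ* GL (Fin n) ℤ_p⟦X⟧`. This file is
the generic, print-free passage «framed lattice representation ⟹ N1's discrete data», i.e. the clauses (cof), (tor), (cof₀), (cof_k), (unr)
of N1 for the realisation `A₂ := (Λ^*)ⁿ` with `G` acting through the matrices `ρ g` (`Λ`-entries acting on `Λ^* = BigRepModule ℤ_[p] p (ℚ_p/ℤ_p)`
through its `ℤ_p⟦X⟧`-module structure `X ↦ τ₁ − 1`). The fibre clauses (fd₀)/(fd_k) need the identification
`A₂[X − C c] ≃ (ℚ_p/ℤ_p)ⁿ` with the SPECIALISED action — the sibling file `…TelescopeBranchCofreeRealisationFibres`.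

CONTENT (namespace `…Theorems.TelescopeBranchCofreeRealisation`; THEOREMS ONLY — every object is produced as `∃`, no `def`):
* §1 `exists_continuousRep_of_isOpen_stabilizer` — a linear representation of a topological group (`ContinuousMul`) on a DISCRETE module
  whose stabilisers are open IS a continuous representation (the continuity half of the tree's `bigRep`, made generic).
* §2 `exists_matrixRepresentation` — for ANY `Λ`-module `N` and `ρ₀ : G →* GL (Fin n) Λ`, the representation of `G` on `Fin n → N`,
  `(g · Ψ) i = Σ_j (ρ₀ g)ᵢⱼ • Ψ j` (`T ⊗_Λ N` for the framed free lattice `T = Λⁿ`).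
* §3 `isOpen_stabilizer_matrixRepresentation` — its stabilisers are open as soon as `ρ₀` is continuous into `GL (Fin n) Λ` (topological
  ring `Λ`) and every element of `N` is killed by an OPEN ideal of `Λ`; `exists_isOpen_ideal_annihilating` — this holds for
  `N = BigRepModule 𝒪 p Q` over `𝒪⟦X⟧` whenever the ideals `(C p^k, X^m)` are open (`p^k`- and `X^m`-torsion of smooth `p`-primary functions).
* §4 `exists_cofreeRealisation` — THE PACKAGE over `Λ = ℤ_p⟦X⟧`, `A₂ = Fin n → BigRepModule ℤ_[p] p (QpModZp p)`: for every continuous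
  `ρ : G →ₜ* GL (Fin n) Λ` there is `ρ₂ : ContinuousRep G Λ A₂` with `(ρ₂ g Ψ) i = Σ_j (ρ g)ᵢⱼ • Ψ j`, and `A₂` satisfies
  `IsCofree Λ A₂` (tree: `AcTwistDeformation.isCofree_bigRepModule_pi` ∘ `BigRepModule.piEquiv`), (tor) `∀ a, ∃ m, X^m • a = 0`,
  (div) `∀ f ≠ 0, f • A₂ = A₂` — hence N1's (cof₀) (`f = X`) and (cof_k) (`f = X − C x_k`); `ker ρ ≤ ker ρ₂`.
* §5 `isUnramifiedOutside_of_framed` — for `G = Γ_K`: `ρ₂` is unramified wherever the framed `ρ` is (N1's (unr) transferred).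

HONEST FRAMING: generic module/representation algebra; it constructs no Hida family, proves no fibre identification with `E[p^∞]` or a
member, closes no registered stub, no crux, no summit statement; BSD is proved for no curve by this file. No named fact, no `sorry`,
no instance, no definition.
References (shape only): [cite: Greenberg2006, p. 342 L4–11 ("`𝒯 = T ⊗ Λ` free of rank n … `𝒟 = 𝒯 ⊗_Λ Λ̂` cofree with a Λ-linear action")]
[cite: Wiles1988, §2 (free lattices for Λ-adic representations)] [cite: Hida1986, Thm. 2.1 (shape of the big Galois representation)]
[cite: SkinnerUrban2014, §3.1.3 and Prop. 3.2.3 (the co-induced model `Λ^* = lim Maps(Γ/Γ^{pⁿ}, ·)`)]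
-/

set_option autoImplicit false
set_option linter.dupNamespace false

noncomputable section

open scoped Classical
open Finset PowerSeries NumberField IsDedekindDomain
open Literature.NumberTheory.EllipticCurves Literature.NumberTheory.IwasawaTheory
  Literature.NumberTheory.IwasawaTheory.Greenberg2016 Literature.NumberTheory.GaloisRepresentations

namespace Summit.BirchSwinnertonDyer.BirchSwinnertonDyer.Theorems.TelescopeBranchCofreeRealisation

universe u v w

/-! ## §1 Discrete modules: open stabilisers ⟹ continuous representation -/

section OpenStabilizer

variable {G : Type u} [Group G] [TopologicalSpace G] [ContinuousMul G]
  {A : Type v} [CommRing A] [TopologicalSpace A]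
  {M : Type w} [AddCommGroup M] [Module A M] [TopologicalSpace M] [DiscreteTopology M]

/-- **A linear representation on a DISCRETE module with OPEN stabilisers is a continuous representation**: the action map
`G × M → M` is locally constant at `(g₀, m)` on the open set `g₀ · Stab(m)⁻¹… × {m}` (translation by `g₀` is continuous,
`ContinuousMul G`). The continuity argument of the tree's `bigRep`, stated for an arbitrary representation.
[cite: SkinnerUrban2014, Prop. 3.2.3 (the discrete Λ-module T ⊗ Λ^* with its continuous G-action)] -/
theorem exists_continuousRep_of_isOpen_stabilizer (π : Representation A G M)
    (h : ∀ m : M, IsOpen {g : G | π g m = m}) :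
    ∃ ρ : ContinuousRep G A M, ρ.toRepresentation = π := by
  refine ⟨⟨π, ?_⟩, rfl⟩
  refine ((IsLocallyConstant.iff_eventually_eq _).mpr ?_).continuous
  rintro ⟨g₀, m⟩
  have hV : IsOpen (((fun g ↦ g₀⁻¹ * g) ⁻¹' {g : G | π g m = m}) ×ˢ ({m} : Set M)) :=
    ((h m).preimage (continuous_const.mul continuous_id)).prod (isOpen_discrete _)
  have hmem : (g₀, m) ∈ ((fun g ↦ g₀⁻¹ * g) ⁻¹' {g : G | π g m = m}) ×ˢ ({m} : Set M) := by
    refine ⟨?_, rfl⟩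
    rw [Set.mem_preimage, Set.mem_setOf_eq, inv_mul_cancel, map_one, Module.End.one_apply]
  filter_upwards [hV.mem_nhds hmem]
  rintro ⟨g, m'⟩ ⟨hg, hm'⟩
  rw [Set.mem_singleton_iff] at hm'
  subst hm'
  rw [Set.mem_preimage, Set.mem_setOf_eq] at hg
  change π g m' = π g₀ m'
  conv_lhs => rw [← mul_inv_cancel_left g₀ g, map_mul, Module.End.mul_apply, hg]

end OpenStabilizer

/-! ## §2 The matrix representation of `GL_n(Λ)` on `Nⁿ` for a `Λ`-module `N` (`= Λⁿ ⊗_Λ N`) -/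

section MatrixRep

variable {Λ : Type u} [CommRing Λ] {N : Type v} [AddCommGroup N] [Module Λ N] {n : ℕ}

/-- `Σ_j 1ᵢⱼ • Ψ j = Ψ i`. [folklore] -/
theorem sum_one_apply_smul (Ψ : Fin n → N) (i : Fin n) :
    ∑ j, (1 : Matrix (Fin n) (Fin n) Λ) i j • Ψ j = Ψ i := by
  simp_rw [Matrix.one_apply, ite_smul, one_smul, zero_smul]
  rw [Finset.sum_ite_eq]
  simp

/-- `Σ_j (MM')ᵢⱼ • Ψ j = Σ_j Mᵢⱼ • Σ_k M'ⱼₖ • Ψ k`. [folklore] -/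
theorem sum_mul_apply_smul (M M' : Matrix (Fin n) (Fin n) Λ) (Ψ : Fin n → N) (i : Fin n) :
    ∑ j, (M * M') i j • Ψ j = ∑ j, M i j • ∑ k, M' j k • Ψ k := by
  simp_rw [Matrix.mul_apply, Finset.sum_smul, Finset.smul_sum, mul_smul]
  rw [Finset.sum_comm]

variable {G : Type w} [Group G]

/-- **The matrix representation on `Nⁿ`**: for a `Λ`-module `N` and `ρ₀ : G →* GL (Fin n) Λ` there is a (unique) `Λ`-linear representation
`π` of `G` on `Fin n → N` with `(π g Ψ) i = Σ_j (ρ₀ g)ᵢⱼ • Ψ j` — the action of `G` on `T ⊗_Λ N` for the framed free lattice `T = Λⁿ`.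
[cite: Greenberg2006, p. 342 L4–11 ("`𝒯 = T ⊗ Λ` … `𝒟 = 𝒯 ⊗_Λ Λ̂` … with a Λ-linear action")] -/
theorem exists_matrixRepresentation (ρ₀ : G →* GL (Fin n) Λ) :
    ∃ π : Representation Λ G (Fin n → N),
      ∀ (g : G) (Ψ : Fin n → N) (i : Fin n), π g Ψ i = ∑ j, ((ρ₀ g : GL (Fin n) Λ) : Matrix (Fin n) (Fin n) Λ) i j • Ψ j := by
  let L : Matrix (Fin n) (Fin n) Λ → ((Fin n → N) →ₗ[Λ] (Fin n → N)) := fun M ↦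
    { toFun := fun Ψ i ↦ ∑ j, M i j • Ψ j,
      map_add' := fun Ψ Ψ' ↦ funext fun i ↦ by
        change ∑ j, M i j • (Ψ j + Ψ' j) = (∑ j, M i j • Ψ j) + ∑ j, M i j • Ψ' j
        simp_rw [smul_add, Finset.sum_add_distrib],
      map_smul' := fun c Ψ ↦ funext fun i ↦ by
        change ∑ j, M i j • (c • Ψ j) = c • ∑ j, M i j • Ψ j
        rw [Finset.smul_sum]
        exact Finset.sum_congr rfl fun j _ ↦ smul_comm (M i j) c (Ψ j) }
  have hL : ∀ M Ψ i, L M Ψ i = ∑ j, M i j • Ψ j := fun _ _ _ ↦ rfl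
  refine ⟨{ toFun := fun g ↦ L ((ρ₀ g : GL (Fin n) Λ) : Matrix (Fin n) (Fin n) Λ),
            map_one' := ?_,
            map_mul' := fun g h ↦ ?_ }, fun g Ψ i ↦ rfl⟩
  · refine LinearMap.ext fun Ψ ↦ funext fun i ↦ ?_
    rw [map_one, Units.val_one, hL, Module.End.one_apply, sum_one_apply_smul]
  · refine LinearMap.ext fun Ψ ↦ funext fun i ↦ ?_
    rw [map_mul, Units.val_mul, hL, Module.End.mul_apply, hL, sum_mul_apply_smul]
    simp_rw [hL]

end MatrixRep

/-! ## §3 Open stabilisers for the matrix representation; open annihilating ideals in `BigRepModule` -/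

section Stabilizer

variable {Λ : Type u} [CommRing Λ] [TopologicalSpace Λ] [IsTopologicalRing Λ]
  {N : Type v} [AddCommGroup N] [Module Λ N] {n : ℕ}
  {G : Type w} [Group G] [TopologicalSpace G] [ContinuousMul G]

/-- **The stabilisers of the matrix representation are open** when `ρ : G →ₜ* GL (Fin n) Λ` is continuous (`Λ` a topological ring) and every
element of `N` is killed by an OPEN ideal: `Stab(Ψ) ⊇ {g | ∀ i j, (ρ g)ᵢⱼ − 1ᵢⱼ ∈ J}` with `J` open killing all `Ψ j`.
[cite: SkinnerUrban2014, §3.1.3 (Λ^* discrete; the G-action on T ⊗ Λ^* is continuous)] -/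
theorem isOpen_stabilizer_matrixRepresentation (ρ : G →ₜ* GL (Fin n) Λ)
    (hN : ∀ m : N, ∃ J : Ideal Λ, IsOpen (J : Set Λ) ∧ ∀ f ∈ J, f • m = 0)
    (π : Representation Λ G (Fin n → N))
    (hπ : ∀ (g : G) (Ψ : Fin n → N) (i : Fin n),
      π g Ψ i = ∑ j, ((ρ g : GL (Fin n) Λ) : Matrix (Fin n) (Fin n) Λ) i j • Ψ j)
    (Ψ : Fin n → N) : IsOpen {g : G | π g Ψ = Ψ} := by
  choose J hJo hJ using fun j ↦ hN (Ψ j)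
  -- the open neighbourhood `U = {g | ∀ i j, (ρ g)ᵢⱼ - 1ᵢⱼ ∈ J j}` of `1`
  have hcont : ∀ i j : Fin n, Continuous fun g : G ↦
      ((ρ g : GL (Fin n) Λ) : Matrix (Fin n) (Fin n) Λ) i j - (1 : Matrix (Fin n) (Fin n) Λ) i j := fun i j ↦
    ((Units.continuous_val.comp (map_continuous ρ)).matrix_elem i j).sub continuous_const
  have hU : IsOpen {g : G | ∀ i j : Fin n,
      ((ρ g : GL (Fin n) Λ) : Matrix (Fin n) (Fin n) Λ) i j - (1 : Matrix (Fin n) (Fin n) Λ) i j ∈ J j} := by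
    have : {g : G | ∀ i j : Fin n,
        ((ρ g : GL (Fin n) Λ) : Matrix (Fin n) (Fin n) Λ) i j - (1 : Matrix (Fin n) (Fin n) Λ) i j ∈ J j} =
        ⋂ i : Fin n, ⋂ j : Fin n, (fun g : G ↦
          ((ρ g : GL (Fin n) Λ) : Matrix (Fin n) (Fin n) Λ) i j - (1 : Matrix (Fin n) (Fin n) Λ) i j) ⁻¹' (J j : Set Λ) := by
      ext g; simp
    rw [this]
    exact isOpen_iInter_of_finite fun i ↦ isOpen_iInter_of_finite fun j ↦ (hJo j).preimage (hcont i j)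
  -- `U ⊆ Stab(Ψ)`
  have hUsub : {g : G | ∀ i j : Fin n,
      ((ρ g : GL (Fin n) Λ) : Matrix (Fin n) (Fin n) Λ) i j - (1 : Matrix (Fin n) (Fin n) Λ) i j ∈ J j} ⊆
      {g : G | π g Ψ = Ψ} := by
    intro g hg
    rw [Set.mem_setOf_eq] at hg ⊢
    funext i
    rw [hπ]
    conv_rhs => rw [← sum_one_apply_smul (Λ := Λ) Ψ i]
    rw [← sub_eq_zero, ← Finset.sum_sub_distrib]
    refine Finset.sum_eq_zero fun j _ ↦ ?_
    rw [← sub_smul]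
    exact hJ j _ (hg i j)
  -- translate
  rw [isOpen_iff_forall_mem_open]
  intro g₀ hg₀
  refine ⟨(fun g ↦ g₀⁻¹ * g) ⁻¹' {g : G | ∀ i j : Fin n,
      ((ρ g : GL (Fin n) Λ) : Matrix (Fin n) (Fin n) Λ) i j - (1 : Matrix (Fin n) (Fin n) Λ) i j ∈ J j},
    fun g hg ↦ ?_, hU.preimage (continuous_const.mul continuous_id), ?_⟩
  · have hg' : π (g₀⁻¹ * g) Ψ = Ψ := hUsub hg
    rw [Set.mem_setOf_eq] at hg₀ ⊢
    rw [← mul_inv_cancel_left g₀ g, map_mul, Module.End.mul_apply, hg', hg₀]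
  · rw [Set.mem_preimage, inv_mul_cancel, Set.mem_setOf_eq]
    intro i j
    rw [map_one, Units.val_one, sub_self]
    exact (J j).zero_mem

end Stabilizer

section Annihilator

variable {𝒪 : Type u} [CommRing 𝒪] {p : ℕ} [Fact p.Prime] {Q : Type v} [AddCommGroup Q] [Module 𝒪 Q]
  [TopologicalSpace (PowerSeries 𝒪)]

/-- **Every smooth `p`-primary function is killed by an OPEN ideal of `𝒪⟦X⟧`**, namely by `(C p^k, X^m)` for its torsion exponent `k`
(`exists_C_natCast_pow_smul_eq_zero`) and nilpotency index `m` (`exists_X_pow_smul_eq_zero`) — as soon as these ideals are open (true for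
the `(p, X)`-adic and for the product topology on `𝒪⟦X⟧`). [cite: SkinnerUrban2014, §3.1.3 (Λ^* = lim Maps(Γ/Γ^{pⁿ}, A[p^k]))] -/
theorem exists_isOpen_ideal_annihilating
    (hΛ : ∀ k m : ℕ, IsOpen ((Ideal.span {PowerSeries.C ((p : 𝒪) ^ k), (PowerSeries.X : PowerSeries 𝒪) ^ m} :
      Ideal (PowerSeries 𝒪)) : Set (PowerSeries 𝒪)))
    (Φ : BigRepModule 𝒪 p Q) :
    ∃ J : Ideal (PowerSeries 𝒪), IsOpen (J : Set (PowerSeries 𝒪)) ∧ ∀ f ∈ J, f • Φ = 0 := by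
  obtain ⟨k, hk⟩ := BigRepModule.exists_C_natCast_pow_smul_eq_zero Φ
  obtain ⟨m, hm⟩ := BigRepModule.exists_X_pow_smul_eq_zero Φ
  refine ⟨_, hΛ k m, fun f hf ↦ ?_⟩
  obtain ⟨a, b, rfl⟩ := Ideal.mem_span_pair.mp hf
  rw [add_smul, mul_smul, mul_smul, map_pow, hk, hm, smul_zero, smul_zero, add_zero]

end Annihilator

/-! ## §4 The package over `Λ = ℤ_p⟦X⟧`: `A₂ = (Λ^*)ⁿ = Fin n → BigRepModule ℤ_[p] p (ℚ_p/ℤ_p)` -/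

section Package

variable {p : ℕ} [Fact p.Prime] {n : ℕ}

/-- (tor) **`A₂ = (Λ^*)ⁿ` is `X`-power torsion**: every element is killed by a power of `X` (coordinatewise `exists_X_pow_smul_eq_zero`,
exponents added up). Generic in the coefficients `𝒪`, `Q`. [cite: SkinnerUrban2014, §3.1.3] -/
theorem exists_X_pow_smul_eq_zero_pi {𝒪 : Type u} [CommRing 𝒪] {Q : Type v} [AddCommGroup Q] [Module 𝒪 Q]
    (Ψ : Fin n → BigRepModule 𝒪 p Q) : ∃ m : ℕ, (PowerSeries.X : PowerSeries 𝒪) ^ m • Ψ = 0 := by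
  choose m hm using fun j ↦ BigRepModule.exists_X_pow_smul_eq_zero (Ψ j)
  refine ⟨∑ j, m j, funext fun j ↦ ?_⟩
  rw [Pi.smul_apply, Pi.zero_apply, ← Nat.sub_add_cancel (Finset.single_le_sum (fun i _ ↦ Nat.zero_le (m i)) (Finset.mem_univ j)),
    pow_add, mul_smul, hm j, smul_zero]

/-- (cof) **`A₂ = (Λ^*)ⁿ` is a COFREE `ℤ_p⟦X⟧`-module** (every Pontryagin dual finite free): the tree's structure theorem
`AcTwistDeformation.isCofree_bigRepModule_pi` for `BigRepModule ℤ_[p] p (Fin n → ℚ_p/ℤ_p)` (dual basis from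
`exists_pi_character_hinj_hsurj_of_linearEquiv`) transported along `BigRepModule.piEquiv`.
[cite: Greenberg2006, p. 342 L4–11 ("`𝒟 = 𝒯 ⊗_Λ Λ̂` is a cofree Λ-module")] -/
theorem isCofree_pi : IsCofree (PowerSeries ℤ_[p]) (Fin n → BigRepModule ℤ_[p] p (QpModZp p)) := by
  obtain ⟨hA, jQ, hinj, hsurj⟩ :=
    AcTwistDeformation.exists_pi_character_hinj_hsurj_of_linearEquiv (LinearEquiv.refl ℤ_[p] (Fin n → QpModZp p))
  exact GreenbergFullAtSelmer.isCofree_of_linearEquiv BigRepModule.piEquiv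
    (AcTwistDeformation.isCofree_bigRepModule_pi hA jQ hinj hsurj)

/-- (div) **`A₂ = (Λ^*)ⁿ` is `Λ`-DIVISIBLE**: `f • A₂ = A₂` for every non-zero `f ∈ ℤ_p⟦X⟧` (`AcTwistDeformation.isDivisible_bigRepModule_pi`
along `piEquiv`). With `f = X` this is N1's (cof₀), with `f = X − C x_k` it is (cof_k).
[cite: Greenberg2016Selmer, §2.5 p. 8 L35–37 (cofree ⟹ divisible)] -/
theorem isDivisible_pi : IsDivisible (PowerSeries ℤ_[p]) (Fin n → BigRepModule ℤ_[p] p (QpModZp p)) := by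
  obtain ⟨hA, jQ, hinj, hsurj⟩ :=
    AcTwistDeformation.exists_pi_character_hinj_hsurj_of_linearEquiv (LinearEquiv.refl ℤ_[p] (Fin n → QpModZp p))
  intro θ hθ Ψ
  obtain ⟨Φ, hΦ⟩ := AcTwistDeformation.isDivisible_bigRepModule_pi hA jQ hinj hsurj θ hθ (BigRepModule.piEquiv.symm Ψ)
  refine ⟨BigRepModule.piEquiv Φ, ?_⟩
  rw [← LinearEquiv.map_smul, hΦ, LinearEquiv.apply_symm_apply]

/-- (cof₀) `A₂` is `X`-divisible. [cite: Greenberg2016Selmer, §2.5 p. 8 L35–37] -/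
theorem exists_X_smul_eq (Ψ : Fin n → BigRepModule ℤ_[p] p (QpModZp p)) :
    ∃ Φ : Fin n → BigRepModule ℤ_[p] p (QpModZp p), (PowerSeries.X : PowerSeries ℤ_[p]) • Φ = Ψ :=
  isDivisible_pi _ PowerSeries.X_ne_zero Ψ

/-- (cof_k) `A₂` is `(X − C c)`-divisible for every `c ∈ ℤ_p`. [cite: Greenberg2016Selmer, §2.5 p. 8 L35–37] -/
theorem exists_X_sub_C_smul_eq (c : ℤ_[p]) (Ψ : Fin n → BigRepModule ℤ_[p] p (QpModZp p)) :
    ∃ Φ : Fin n → BigRepModule ℤ_[p] p (QpModZp p), (PowerSeries.X - PowerSeries.C c : PowerSeries ℤ_[p]) • Φ = Ψ := by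
  refine isDivisible_pi _ (fun h ↦ ?_) Ψ
  have h1 := congrArg (PowerSeries.coeff 1) h
  rw [map_sub, PowerSeries.coeff_one_X, PowerSeries.coeff_C, if_neg one_ne_zero, sub_zero, map_zero] at h1
  exact one_ne_zero h1

variable {G : Type w} [Group G] [TopologicalSpace G] [ContinuousMul G]
  [TopologicalSpace (PowerSeries ℤ_[p])] [IsTopologicalRing (PowerSeries ℤ_[p])]

/-- **THE COFREE REALISATION** of a continuous framed `Λ`-adic representation `ρ : G →ₜ* GL_n(ℤ_p⟦X⟧)` (any topology on `ℤ_p⟦X⟧`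
making it a topological ring in which the ideals `(C p^k, X^m)` are open): a continuous `Λ`-linear representation `ρ₂` of `G` on the
DISCRETE module `A₂ = (Λ^*)ⁿ = Fin n → BigRepModule ℤ_[p] p (ℚ_p/ℤ_p)` — `= T ⊗_Λ Λ^∨` for the framed free lattice `T = Λⁿ` — acting
through the matrices, `(ρ₂ g Ψ) i = Σ_j (ρ g)ᵢⱼ • Ψ j`, with `ker ρ ≤ ker ρ₂`. Together with `isCofree_pi`, `exists_X_pow_smul_eq_zero_pi`,
`isDivisible_pi` this gives the clauses (cof), (tor), (cof₀), (cof_k) of leaf N1 for this `A₂`.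
[cite: Greenberg2006, p. 342 L4–11] [cite: SkinnerUrban2014, Prop. 3.2.3] -/
theorem exists_cofreeRealisation
    (hΛ : ∀ k m : ℕ, IsOpen ((Ideal.span {PowerSeries.C ((p : ℤ_[p]) ^ k), (PowerSeries.X : PowerSeries ℤ_[p]) ^ m} :
      Ideal (PowerSeries ℤ_[p])) : Set (PowerSeries ℤ_[p])))
    (ρ : G →ₜ* GL (Fin n) (PowerSeries ℤ_[p])) :
    ∃ ρ₂ : ContinuousRep G (PowerSeries ℤ_[p]) (Fin n → BigRepModule ℤ_[p] p (QpModZp p)),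
      (∀ (g : G) (Ψ : Fin n → BigRepModule ℤ_[p] p (QpModZp p)) (i : Fin n),
        ρ₂ g Ψ i = ∑ j, ((ρ g : GL (Fin n) (PowerSeries ℤ_[p])) : Matrix (Fin n) (Fin n) (PowerSeries ℤ_[p])) i j • Ψ j) ∧
      ∀ g : G, ρ g = 1 → ∀ Ψ : Fin n → BigRepModule ℤ_[p] p (QpModZp p), ρ₂ g Ψ = Ψ := by
  obtain ⟨π, hπ⟩ := exists_matrixRepresentation (N := BigRepModule ℤ_[p] p (QpModZp p)) ρ.toMonoidHom
  have hπ' : ∀ (g : G) (Ψ : Fin n → BigRepModule ℤ_[p] p (QpModZp p)) (i : Fin n),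
      π g Ψ i = ∑ j, ((ρ g : GL (Fin n) (PowerSeries ℤ_[p])) : Matrix (Fin n) (Fin n) (PowerSeries ℤ_[p])) i j • Ψ j := hπ
  obtain ⟨ρ₂, hρ₂⟩ := exists_continuousRep_of_isOpen_stabilizer π
    (isOpen_stabilizer_matrixRepresentation ρ (exists_isOpen_ideal_annihilating hΛ) π hπ')
  refine ⟨ρ₂, fun g Ψ i ↦ ?_, fun g hg Ψ ↦ ?_⟩
  · rw [← ContinuousRep.toRepresentation_apply, hρ₂, hπ']
  · funext i
    rw [← ContinuousRep.toRepresentation_apply, hρ₂, hπ', hg, Units.val_one, sum_one_apply_smul]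

end Package

/-! ## §5 Unramifiedness transfers from the frame (N1's (unr)) -/

section Unramified

variable {K : Type} [Field K] {Λ : Type u} [CommRing Λ] [TopologicalSpace Λ]
  {M : Type v} [AddCommGroup M] [Module Λ M] [TopologicalSpace M] {n : ℕ}

/-- **`ρ₂` is unramified wherever the framed `ρ` is**, for any Galois representation `ρ₂` killed by `ker ρ` (e.g. the cofree realisation of
`ρ`, `exists_cofreeRealisation`): N1's clause (unr) `GaloisRep.IsUnramifiedOutside S₀ ρ₂` from the frame's `FramedGaloisRep.IsUnramifiedAt`.
[cite: Hida1986, Thm. 2.1 (2.2b) ("π is unramified outside Np")] -/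
theorem isUnramifiedOutside_of_framed (ρ : FramedGaloisRep K Λ n) (ρ₂ : GaloisRep K Λ M)
    (hker : ∀ σ : Field.absoluteGaloisGroup K, ρ σ = 1 → ∀ m : M, ρ₂ σ m = m)
    {S₀ : Set (HeightOneSpectrum (𝓞 K))} (hS₀ : ∀ v ∉ S₀, FramedGaloisRep.IsUnramifiedAt v ρ) :
    GaloisRep.IsUnramifiedOutside S₀ ρ₂ := by
  intro v hv 𝔓 h𝔓 σ hσ
  exact LinearMap.ext fun m ↦ hker σ (hS₀ v hv 𝔓 h𝔓 σ hσ) m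

end Unramified

end Summit.BirchSwinnertonDyer.BirchSwinnertonDyer.Theorems.TelescopeBranchCofreeRealisation

end
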